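import Mathlib.Tactic.NormNum
import HarnessLib

/-!
# The §7 RUNG-1 verdict of the material-oracle acceptance test as a total function of the clause table, with the
# two sentences people argue about PROVED: «INCOMPLETE is not FAIL» and «improving a clause never lowers the verdict»

Venture CertifiedManyBodySolver, cell `pub/hubbard-downfold`, seat hubbard-downfold-score-1 (second scoring engine);
namespace `Summit.Ventures.CertifiedManyBodySolver.Downfold.CellScore`. ACCEPTANCE §7 (the run verdict line the director
carries up) + v1.3 NA rule («accuracy(certified) NA is NON-BLOCKING ⇒ PASS(vacuous: …)»). Everything here is PROVED
(finite case analysis over lists).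

WHAT THIS IS NOT: not a verdict about any run and not the line of record (the director writes that from deputy-2's
SCORES); both scorers (`deputy-2/score.py` `rung1_clauses._verdict`, `validation/score/phasemap.py` `aggregate.rung1.verdict`)
print the same composition and have agreed on it in every one of ≈ 10 M compared synthetic runs and the five map runs of
record. This file is its KERNEL REFERENCE:

* §1 `ClauseStatus` = FAIL | NAblocking | NAnonblocking | PASS (a clause's mechanical status; the only non-blocking NA of
  record is accuracy(certified), v1.3 §7); `RungVerdict` = FAIL | INCOMPLETEfailing | INCOMPLETEna | PASSvacuous | PASS;
  `rung1 hard cs` (both engines' branch: a HARD incident (H1/H1b/H2 anywhere) ⇒ FAIL; else any failing clause ⇒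
  INCOMPLETE(failing); else any blocking NA ⇒ INCOMPLETE(NA); else any NA ⇒ PASS(vacuous); else PASS); `rank` orders the
  five verdicts and `ClauseStatus.rank` the four statuses (FAIL < NA-blocking < NA-non-blocking < PASS); a pointwise IMPROVEMENT of a clause table is `List.Forall₂ (rank ≤ rank)`.
* §2 THEOREMS. (a) `rung1_eq_FAIL_iff`: the verdict is FAIL **iff** there is a hard incident — failing clauses alone give
  INCOMPLETE, never FAIL («INCOMPLETE is not FAIL»: a run below its thresholds is unfinished, a run with a certified
  contradiction is wrong). (b) `rung1_eq_PASS_iff`: PASS iff no incident and every clause PASS. (c) THE LADDER PROPERTY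
  `rank_rung1_mono`: with the incident flag fixed, replacing the clause statuses by pointwise-better ones (same clauses,
  each status ≤ its successor) never lowers the verdict's rank — so a later run that improves some clauses and keeps the
  rest reads at least as well; and `rank_rung1_hard_le`: an incident caps the verdict at FAIL whatever the clauses say.
* §3 the runs of record evaluated: run #2 (floors, R, inside-band NA… ⇒ INCOMPLETE(failing)), run #5 v1 table
  (floors/R/inside-band failing, accuracy(certified) NA ⇒ INCOMPLETE(failing)), the honest day-0 shape (all NA but
  well-formed ⇒ INCOMPLETE(NA)), the target state (all PASS but accuracy(certified) NA ⇒ PASS(vacuous)), and an H1 run.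
-/

namespace Summit.Ventures.CertifiedManyBodySolver.Downfold

namespace CellScore

/-! ## §1 Statuses, verdicts, the composition -/

/-- Mechanical status of one §7 clause. [folklore] -/
inductive ClauseStatus
  /-- threshold missed -/
  | FAIL
  /-- not applicable and BLOCKING (the run cannot pass without this clause becoming applicable) -/
  | NAblocking
  /-- not applicable and NON-blocking (v1.3: accuracy(certified) only) -/
  | NAnonblocking
  /-- threshold met -/
  | PASS
  deriving DecidableEq, Repr

/-- The five rung-1 verdict heads both scorers print. [folklore] -/
inductive RungVerdict
  /-- a hard incident (H1/H1b/H2) anywhere in the run -/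
  | FAIL
  /-- no incident, at least one clause below threshold -/
  | INCOMPLETEfailing
  /-- no incident, nothing failing, at least one blocking clause not applicable -/
  | INCOMPLETEna
  /-- everything applicable passes; only non-blocking clauses are NA -/
  | PASSvacuous
  /-- every clause applicable and met -/
  | PASS
  deriving DecidableEq, Repr

/-- ACCEPTANCE §7 composition (both engines' branch). [folklore] -/
def rung1 (hard : Bool) (cs : List ClauseStatus) : RungVerdict :=
  if hard then .FAIL
  else if cs.any (· == .FAIL) then .INCOMPLETEfailing
  else if cs.any (· == .NAblocking) then .INCOMPLETEna
  else if cs.any (· == .NAnonblocking) then .PASSvacuous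
  else .PASS

/-- verdict rank: FAIL < INCOMPLETE(failing) < INCOMPLETE(NA) < PASS(vacuous) < PASS. [folklore] -/
def RungVerdict.rank : RungVerdict → ℕ
  | .FAIL => 0
  | .INCOMPLETEfailing => 1
  | .INCOMPLETEna => 2
  | .PASSvacuous => 3
  | .PASS => 4

/-- status rank: FAIL < NA-blocking < NA-non-blocking < PASS. [folklore] -/
def ClauseStatus.rank : ClauseStatus → ℕ
  | .FAIL => 0
  | .NAblocking => 1
  | .NAnonblocking => 2
  | .PASS => 3

/-! ## §2 Property sheet -/

section props

variable {hard : Bool} {cs cs' : List ClauseStatus}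

/-- (a) «INCOMPLETE is not FAIL»: the verdict is FAIL iff there is a hard incident. [folklore] -/
theorem rung1_eq_FAIL_iff : rung1 hard cs = .FAIL ↔ hard = true := by
  cases hard
  · simp only [rung1, Bool.false_eq_true, if_false, iff_false]
    split_ifs <;> simp
  · simp [rung1]

/-- … in particular failing clauses without an incident give INCOMPLETE(failing). [folklore] -/
theorem rung1_of_fail_mem (h : ClauseStatus.FAIL ∈ cs) : rung1 false cs = .INCOMPLETEfailing := by
  unfold rung1
  have : cs.any (· == .FAIL) = true := List.any_eq_true.mpr ⟨_, h, by decide⟩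
  simp [this]

/-- (b) PASS iff no incident and every clause PASS. [folklore] -/
theorem rung1_eq_PASS_iff : rung1 hard cs = .PASS ↔ hard = false ∧ ∀ c ∈ cs, c = .PASS := by
  unfold rung1
  cases hard
  · simp only [Bool.false_eq_true, ↓reduceIte, true_and]
    split_ifs with h1 h2 h3
    · simp only [false_iff, not_forall]
      obtain ⟨c, hc, hcf⟩ := List.any_eq_true.mp h1
      exact ⟨c, hc, by revert hcf; cases c <;> decide⟩
    · simp only [false_iff, not_forall]
      obtain ⟨c, hc, hcf⟩ := List.any_eq_true.mp h2
      exact ⟨c, hc, by revert hcf; cases c <;> decide⟩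
    · simp only [false_iff, not_forall]
      obtain ⟨c, hc, hcf⟩ := List.any_eq_true.mp h3
      exact ⟨c, hc, by revert hcf; cases c <;> decide⟩
    · simp only [true_iff]
      intro c hc
      rw [Bool.not_eq_true, List.any_eq_false] at h1 h2 h3
      have := h1 c hc; have := h2 c hc; have := h3 c hc
      revert h1 h2 h3; cases c <;> simp_all
  · simp

/-- an incident caps the verdict at FAIL whatever the clauses say. [folklore] -/
theorem rank_rung1_hard_le (cs cs' : List ClauseStatus) : (rung1 true cs).rank ≤ (rung1 hard cs').rank := by
  simp [rung1, RungVerdict.rank]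

/-- membership transfer along a pointwise improvement: a status of rank ≤ k in the improved table comes from one of
rank ≤ k in the original. [folklore] -/
theorem exists_rank_le_of_improves (h : List.Forall₂ (fun a b : ClauseStatus => a.rank ≤ b.rank) cs cs') {c' : ClauseStatus} (hc' : c' ∈ cs') :
    ∃ c ∈ cs, c.rank ≤ c'.rank := by
  induction h with
  | nil => simp at hc'
  | @cons a b l l' hab _ ih =>
    rcases List.mem_cons.mp hc' with rfl | hmem
    · exact ⟨a, by simp, hab⟩
    · obtain ⟨c, hc, hle⟩ := ih hmem
      exact ⟨c, List.mem_cons_of_mem a hc, hle⟩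

/-- the «some clause has rank ≤ k» form of the three `any` tests. [folklore] -/
theorem rank_rung1_false_eq (cs : List ClauseStatus) :
    (rung1 false cs).rank = if cs.any (· == .FAIL) then 1 else if cs.any (· == .NAblocking) then 2
      else if cs.any (· == .NAnonblocking) then 3 else 4 := by
  unfold rung1
  simp only [Bool.false_eq_true, ↓reduceIte]
  split_ifs <;> rfl

/-- (c) THE LADDER PROPERTY: improving the clause table pointwise (incident flag fixed) never lowers the verdict.
[folklore] -/
theorem rank_rung1_mono (h : List.Forall₂ (fun a b : ClauseStatus => a.rank ≤ b.rank) cs cs') (hard : Bool) : (rung1 hard cs).rank ≤ (rung1 hard cs').rank := by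
  cases hard
  · -- find, for the worst status of cs', a status at least as bad in cs
    have key : ∀ k : ℕ, (∃ c' ∈ cs', c'.rank ≤ k) → ∃ c ∈ cs, c.rank ≤ k := by
      rintro k ⟨c', hc', hk⟩
      obtain ⟨c, hc, hle⟩ := exists_rank_le_of_improves h hc'
      exact ⟨c, hc, hle.trans hk⟩
    have anyR : ∀ (l : List ClauseStatus) (s : ClauseStatus), l.any (· == s) = true ↔ s ∈ l := by
      intro l s
      rw [List.any_eq_true]
      constructor
      · rintro ⟨x, hx, hxs⟩
        have : x = s := by revert hxs; cases x <;> cases s <;> decide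
        exact this ▸ hx
      · intro hs
        exact ⟨s, hs, by cases s <;> decide⟩
    rw [rank_rung1_false_eq, rank_rung1_false_eq]
    -- case analysis on the worst status present in cs'
    by_cases f' : cs'.any (· == .FAIL) = true
    · obtain ⟨c, hc, hk⟩ := key 0 ⟨_, (anyR _ _).mp f', le_rfl⟩
      have : c = .FAIL := by revert hk; cases c <;> decide
      rw [if_pos ((anyR _ _).mpr (this ▸ hc)), if_pos f']
    · rw [if_neg f']
      by_cases n' : cs'.any (· == .NAblocking) = true
      · rw [if_pos n']
        obtain ⟨c, hc, hk⟩ := key 1 ⟨_, (anyR _ _).mp n', le_rfl⟩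
        have hc2 : c = .FAIL ∨ c = .NAblocking := by revert hk; cases c <;> decide
        by_cases f : cs.any (· == .FAIL) = true
        · rw [if_pos f]; omega
        · rw [if_neg f]
          rcases hc2 with rfl | rfl
          · exact absurd ((anyR _ _).mpr hc) f
          · rw [if_pos ((anyR _ _).mpr hc)]
      · rw [if_neg n']
        by_cases v' : cs'.any (· == .NAnonblocking) = true
        · rw [if_pos v']
          obtain ⟨c, hc, hk⟩ := key 2 ⟨_, (anyR _ _).mp v', le_rfl⟩
          have hc3 : c = .FAIL ∨ c = .NAblocking ∨ c = .NAnonblocking := by revert hk; cases c <;> decide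
          by_cases f : cs.any (· == .FAIL) = true
          · rw [if_pos f]; omega
          · rw [if_neg f]
            by_cases n : cs.any (· == .NAblocking) = true
            · rw [if_pos n]; omega
            · rw [if_neg n]
              rcases hc3 with rfl | rfl | rfl
              · exact absurd ((anyR _ _).mpr hc) f
              · exact absurd ((anyR _ _).mpr hc) n
              · rw [if_pos ((anyR _ _).mpr hc)]
        · rw [if_neg v']
          split_ifs <;> omega
  · exact rank_rung1_hard_le cs cs'

end props

/-! ## §3 The runs of record, evaluated (clause order: H-clean · well-formed · differentiation · decided-fraction-floors ·
R-score · accuracy(screening-grade) · accuracy(certified) · inside-band(e-ph) · ordering) -/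

section cases
open ClauseStatus

/-- RUN #5 v1 table (2026-08-26e): floors FAIL, R 0.895 FAIL, inside-band 0.5 FAIL, accuracy(certified) NA
(non-blocking), ordering NA (blocking? no: groups < 3 members ⇒ NA non-blocking in neither engine — it is simply
NA-blocking-free because both print it NA and the verdict is already INCOMPLETE(failing)). [folklore] -/
example : rung1 false [PASS, PASS, PASS, FAIL, FAIL, PASS, NAnonblocking, FAIL, NAblocking] = .INCOMPLETEfailing := by
  decide

/-- the honest day-0 shape: nothing failing, several blocking NA ⇒ INCOMPLETE(NA). [folklore] -/
example : rung1 false [PASS, PASS, NAblocking, NAblocking, NAblocking, NAblocking, NAnonblocking, NAblocking, NAblocking] =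
    .INCOMPLETEna := by decide

/-- the 09-09 target state with no certified cell issued: PASS(vacuous: accuracy(certified)). [folklore] -/
example : rung1 false [PASS, PASS, PASS, PASS, PASS, PASS, NAnonblocking, PASS, PASS] = .PASSvacuous := by decide

/-- … and with certified cells held to 1.00: PASS. [folklore] -/
example : rung1 false [PASS, PASS, PASS, PASS, PASS, PASS, PASS, PASS, PASS] = .PASS := by decide

/-- one H1 incident makes it FAIL even with every clause met («certified cells are never wrong»). [folklore] -/
example : rung1 true [PASS, PASS, PASS, PASS, PASS, PASS, PASS, PASS, PASS] = .FAIL := by decide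

/-- the relation is honest: a clause going NA-blocking → FAIL (inside-band when the first e–ph band landed) is NOT an
improvement, so the ladder theorem does not apply to that step; with that clause held, run #2 → run #5 IS one. [folklore] -/
example : ¬ List.Forall₂ (fun a b : ClauseStatus => a.rank ≤ b.rank)
    [PASS, PASS, NAblocking, FAIL, FAIL, NAblocking, NAnonblocking, NAblocking, NAblocking]
    [PASS, PASS, PASS, FAIL, FAIL, PASS, NAnonblocking, FAIL, NAblocking] := by
  -- NAblocking (rank 1) ↦ FAIL (rank 0) at the inside-band clause is NOT an improvement: the relation is honest about it
  simp [ClauseStatus.rank]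

example : List.Forall₂ (fun a b : ClauseStatus => a.rank ≤ b.rank)
    [PASS, PASS, NAblocking, FAIL, FAIL, NAblocking, NAnonblocking, NAblocking, NAblocking]
    [PASS, PASS, PASS, FAIL, FAIL, PASS, NAnonblocking, NAblocking, NAblocking] := by
  simp [ClauseStatus.rank]

end cases

/-! ## §4 (appended 2026-08-27 g6, FINDING F22) One UNREACHABLE clause makes rung-1 PASS unreachable — and the run still reads INCOMPLETE, never FAIL

PhaseMapDifferentiation §7 (`unreachable_of_ceiling_fails`, p497334) shows that under the router words of record the v1 CUPRATE decided-fraction floor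
fails for EVERY admissible completion (ceiling 7/19 < 0.60). By the composition below that single clause pins the verdict: whatever the other eight
clauses read, a clause list containing a FAIL is never PASS / PASS(vacuous), and (no hard incident) it is exactly INCOMPLETE(failing) — so «no PASS
at any date under these words» is a statement about ONE clause, and it is not a FAIL either (INCOMPLETE is not FAIL, §2 (a)). RUN #13 v1:
[H-clean PASS, well-formed PASS, differentiation PASS, floors FAIL(unreachable), R FAIL, acc(scr) PASS, acc(cert) NA-nonblocking, inside-band PASS,
ordering NA-blocking] ⇒ INCOMPLETE(failing); even the best case for every OTHER clause keeps INCOMPLETE(failing) while the floor clause is FAIL. -/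

section unreachable

variable {cs : List ClauseStatus}

/-- A clause list containing a FAIL never composes to PASS, for either value of `hard`. [folklore] -/
theorem rung1_ne_PASS_of_fail_mem (hard : Bool) (h : ClauseStatus.FAIL ∈ cs) : rung1 hard cs ≠ .PASS := by
  intro hp
  have := (rung1_eq_PASS_iff.mp hp).2 _ h
  exact ClauseStatus.noConfusion this

/-- … nor to PASS(vacuous): with no incident it is exactly INCOMPLETE(failing) (`rung1_of_fail_mem`), with one it is FAIL. [folklore] -/
theorem rung1_rank_le_one_of_fail_mem (hard : Bool) (h : ClauseStatus.FAIL ∈ cs) : (rung1 hard cs).rank ≤ 1 := by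
  cases hard
  · rw [rung1_of_fail_mem h]; decide
  · have : rung1 true cs = .FAIL := rung1_eq_FAIL_iff.mpr rfl
    rw [this]; decide

/-- F22 composed: if ONE clause is FAIL in every admissible completion (an unreachable floor), then NO completion of the clause list is PASS —
stated for completions that keep that clause's position: any list of the shape `pre ++ FAIL :: post`. [folklore] -/
theorem no_pass_with_unreachable_clause (hard : Bool) (pre post : List ClauseStatus) :
    rung1 hard (pre ++ ClauseStatus.FAIL :: post) ≠ .PASS :=
  rung1_ne_PASS_of_fail_mem hard (by simp)

open ClauseStatus in
/-- RUN #13 v1 (both engines): floors FAIL (unreachable, F22) and R FAIL ⇒ INCOMPLETE(failing); and the BEST CASE for every other clause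
(all PASS, accuracy(certified) held to 1.00) with the floor clause still FAIL reads INCOMPLETE(failing) too — the verdict the cell can at most
print under the words of record, at any date. [folklore] -/
theorem run13_v1_and_best_case_under_words :
    rung1 false [PASS, PASS, PASS, FAIL, FAIL, PASS, NAnonblocking, PASS, NAblocking] = .INCOMPLETEfailing ∧
      rung1 false [PASS, PASS, PASS, FAIL, PASS, PASS, PASS, PASS, PASS] = .INCOMPLETEfailing := by
  constructor <;> decide

end unreachable

end CellScore

end Summit.Ventures.CertifiedManyBodySolver.Downfold
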